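import Mathlib
import HarnessLib
import Summits.ResolutionOfSingularities.ResolutionOfSingularities.Theorems.WildQuotientsWildQuotientResolutionS1aKillShift

/-!
# S1a — NECESSITY OF BOUNDARY-ADMISSIBILITY: (H1) for `g = β s^δ` IS (a′)_δ

[OURS · L1 W4.5c · lead-1 g10; FRAME-STATUS rev10 §4 research note «necessity of (a′) ∧ (i) for the kill clause (local uniqueness)»] — NOT statements of the
manuscript; counted 0; AI-level work, weaker than expert review. Crux stmt-ResolutionOfSingularities-17941 `CyclicQuotientFourfolds`, line `s1a-logminvertex`
v10, K-side (`stub_killTouchReachAux`). Route-independent; pure algebra.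

The sufficient condition (a′)_δ ⇒ (H1)(β s^δ) is `augmentationIdeal_sigmaR_le_span_of_admissible_shift` (p639579). Here the CONVERSE: if every increment
`σ_R z − z` of the cobordant algebra is a multiple of `β s^δ`, then `y ∈ 𝒥ₙ ⇒ σ y − y ∈ β 𝒥ₙ₊δ` — read off the coefficient of `tⁿ` in
`σ_R (y tⁿ) − y tⁿ = (β s^δ) q`, the coefficient of `tⁿ⁺δ` in `q ∈ R^w = ⊕ 𝒥ₘ tᵐ` lying in `𝒥ₙ₊δ`. So boundary-admissibility is not an extra hypothesis of the
kill criterion but is FORCED by the shape `β s^δ` of the certificate: `admissible_iff_augmentationIdeal_le_span`.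

* `coeff_mem_of_mem` — coefficients of elements of `R^w` lie in the weighted filtration;
* ★★ `admissible_of_augmentationIdeal_le_span` — (H1)(β s^δ) ⇒ (a′)_δ; ★ `admissible_iff_augmentationIdeal_le_span` — (a′)_δ ⟺ (H1)(β s^δ).
-/

set_option linter.dupNamespace false

noncomputable section

open Literature.AlgebraicGeometry.Resolution
open scoped LaurentPolynomial
open LaurentPolynomial
open Summit.ResolutionOfSingularities.ResolutionOfSingularities.Theorems.WildQuotientResolution.S1.CoarseChart

namespace Summit.ResolutionOfSingularities.ResolutionOfSingularities.Theorems.WildQuotientResolution.S1.KillCert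

universe u

variable {B : Type u} [CommRing B] {c : ℕ} (f : Fin c → B) (w : Fin c → ℕ) (σ : B ≃+* B)
  (hσJ : ∀ n : ℕ, ((weightedFiltration f w).ideal n).map (σ : B →+* B) ≤ (weightedFiltration f w).ideal n)
  {p : ℕ} (hp : 0 < p) (hσp : ∀ x : B, (⇑σ)^[p] x = x)

/-- The coefficient of `tᵐ` of an element of `R^w = ⊕ 𝒥ₘ tᵐ ⊕ B[t⁻¹]` lies in `𝒥ₘ`. [folklore] -/
theorem coeff_mem_of_mem (q : ↥(cobordantAlgebra f w)) (m : ℕ) : (q : B[T;T⁻¹]).coeff (m : ℤ) ∈ (weightedFiltration f w).ideal m := by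
  have hq : (q : B[T;T⁻¹]) ∈ (weightedFiltration f w).extendedRees := by
    rw [← cobordantAlgebra_eq_extendedRees]; exact q.2
  exact ((weightedFiltration f w).mem_extendedRees_iff.mp hq) m

/-- ★★ **(H1) for `g = β s^δ` forces boundary-admissibility (a′)_δ.** If every increment of `σ_R` on `R^w` is a multiple of `β s^δ` then
`y ∈ 𝒥ₙ ⇒ σ y − y ∈ β · 𝒥ₙ₊δ`: compare the coefficients of `tⁿ` in `σ_R (y tⁿ) − y tⁿ = (β s^δ) · q`. [OURS · L1 W4.5c; NOT a statement of the manuscript] -/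
theorem admissible_of_augmentationIdeal_le_span (β : B) (δ : ℕ)
    (h1 : augmentationIdeal (sigmaR σ f w hσJ hp hσp) ≤
      Ideal.span {algebraMap B (↥(cobordantAlgebra f w)) β * cobordantAlgebra.s f w ^ δ})
    (n : ℕ) (y : B) (hy : y ∈ (weightedFiltration f w).ideal n) :
    σ y - y ∈ Ideal.span {β} * (weightedFiltration f w).ideal (n + δ) := by
  let z : ↥(cobordantAlgebra f w) := ⟨C y * T (n : ℤ), C_mul_T_mem_cobordantAlgebra f w hy⟩
  obtain ⟨q, hq⟩ := Ideal.mem_span_singleton'.mp (h1 (sub_mem_augmentationIdeal (sigmaR σ f w hσJ hp hσp) z))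
  -- underlying Laurent polynomials
  have hcoe : (q : B[T;T⁻¹]) * (C β * T (-(δ : ℤ))) = C (σ y - y) * T (n : ℤ) := by
    have := congrArg Subtype.val hq
    rw [MulMemClass.coe_mul, MulMemClass.coe_mul, cobordantAlgebra.coe_algebraMap, cobordantAlgebra.coe_s_pow,
      AddSubgroupClass.coe_sub, coe_sigmaR] at this
    rw [this]
    change sigmaT σ (C y * T (n : ℤ)) - C y * T (n : ℤ) = _
    rw [sigmaT_C_mul_T, map_sub, sub_mul]
  -- the coefficient of `tⁿ`
  have hl : ((q : B[T;T⁻¹]) * (C β * T (-(δ : ℤ)))).coeff (n : ℤ) = (q : B[T;T⁻¹]).coeff ((n + δ : ℕ) : ℤ) * β := by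
    have hidx : (n : ℤ) = ((n + δ : ℕ) : ℤ) + (-(δ : ℤ)) := by push_cast; ring
    rw [← single_eq_C_mul_T, hidx, AddMonoidAlgebra.coeff_mul_single_add]
  have hr : (C (σ y - y) * T (n : ℤ)).coeff (n : ℤ) = σ y - y := by
    rw [← single_eq_C_mul_T, AddMonoidAlgebra.coeff_single, Finsupp.single_eq_same]
  have key : σ y - y = β * (q : B[T;T⁻¹]).coeff ((n + δ : ℕ) : ℤ) := by
    rw [← hr, ← hcoe, hl, mul_comm]
  rw [key]
  exact Ideal.mul_mem_mul (Ideal.mem_span_singleton_self β) (coeff_mem_of_mem f w q (n + δ))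

/-- ★ **(a′)_δ ⟺ (H1)(β s^δ)**: boundary-admissibility with shift `δ` is EQUIVALENT to «every increment of `σ_R` is a multiple of `β s^δ`».
[OURS · L1 W4.5c; NOT a statement of the manuscript] -/
theorem admissible_iff_augmentationIdeal_le_span (β : B) (δ : ℕ) :
    (∀ (n : ℕ) (y : B), y ∈ (weightedFiltration f w).ideal n → σ y - y ∈ Ideal.span {β} * (weightedFiltration f w).ideal (n + δ)) ↔
      augmentationIdeal (sigmaR σ f w hσJ hp hσp) ≤
        Ideal.span {algebraMap B (↥(cobordantAlgebra f w)) β * cobordantAlgebra.s f w ^ δ} :=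
  ⟨augmentationIdeal_sigmaR_le_span_of_admissible_shift f w σ hσJ hp hσp δ β,
    admissible_of_augmentationIdeal_le_span f w σ hσJ hp hσp β δ⟩

end Summit.ResolutionOfSingularities.ResolutionOfSingularities.Theorems.WildQuotientResolution.S1.KillCert

end
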